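import Literature.NumberTheory.EllipticCurves.PointCountEulerCriterion
import HarnessLib

/-!
# BSD rank-≤1 residual cell, class X11 ∧ r = 1 ∧ ¬sst ∧ p ≥ 5: Frobenius point-count certificates
# `#Ẽ(𝔽_ℓ) = n` for the 85 record models (part 1 of 2; kernel-decided data)

HONEST FRAMING (cell `b2b-bsdres-*`, verbatim): prove what is provable now; shrink each hard class
to its core with data; no claim beyond stated classes; COMBINATION classes deleted from PUBLISHED
theorems only, CONSTRUCTION-shaped remainder typed; this is not "finishing BSD".

Theorems only (kernel-decided data: no definition, no named fact, no `native_decide`), in the exact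
shape of the tree's `RationalIsogenyFrobeniusCertificates*.lean` (`card_<E>_<ℓ>`): for each record
`r` of `X11RankOneCertificates.records{1,2}` (unit `b2b-bsdres-x11c`; Cremona label in the theorem
name, a-invariants literal) and ONE odd prime `ℓ` of good reduction (`ℓ ∤ Δ`, `ℓ ≠ p`, the smallest
one for which `X² − a_ℓX + ℓ` has no root modulo the record's prime `p`), the point count
`#Ẽ(𝔽_ℓ) = n` of the reduction of the record's integer model, on `E.map (Int.castRingHom (ZMod ℓ))`
— the shape of `WeierstrassCurve.reductionPointCount` —, decided by the kernel through
`WeierstrassCurve.natCard_point_eq_one_add_card` and `card_sol_eq_sum_euler` (Euler's criterion,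
column by column). Consumer: `Rank1ResidualX11RankOneReduction.lean`, where `a_ℓ = ℓ + 1 − n` and
the root-freeness of `X² − a_ℓX + ℓ (mod p)` (decided there) give `E[p]` irreducible by Mazur 1978
Prop. 6.3 (1) (`IntModel.hasIrreducibleModPGaloisRep_of_intModel_of_noroot`). The witnesses were
found by the seat's script `work/gen/compute_certs.py` (naive count); the kernel RE-VERIFIES every
count here, which is the only thing these theorems rely on.

References: B. Mazur, Invent. Math. 44 (1978) Prop. 6.3 (1) [Mazur1978]; K. Ireland, M. Rosen, GTM 84
(1990) Prop. 5.1.2, §8.1 [IrelandRosen1990]; J. E. Cremona, *Algorithms for Modular Elliptic Curves*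
(1997), Table 1 (labels) [CremonaAlgorithms1997].
-/

set_option linter.dupNamespace false

namespace Summit.BirchSwinnertonDyer.BirchSwinnertonDyer.Rank1Residual.X11RankOne

open Literature.NumberTheory.EllipticCurves

/-- `#Ẽ(𝔽_11) = 16` (`a_11 = -4`; `X² − a_11X + 11` root-free mod `p = 5`) for record `2760k1`. [folklore] -/
theorem card_c2760k1_11 :
    Nat.card (((⟨0, 1, 0, 7615, 1127283⟩ : WeierstrassCurve ℤ).map (Int.castRingHom (ZMod 11))).toAffine.Point) = 16 := by
  rw [@WeierstrassCurve.natCard_point_eq_one_add_card (ZMod 11) (@ZMod.instField 11 ⟨by norm_num⟩) _ _ _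
    (by decide +kernel), @card_sol_eq_sum_euler (ZMod 11) (@ZMod.instField 11 ⟨by norm_num⟩) _ _
    (by rw [ZMod.ringChar_zmod_n]; decide), ZMod.card]
  decide +kernel

/-- `#Ẽ(𝔽_13) = 16` (`a_13 = -2`; `X² − a_13X + 13` root-free mod `p = 5`) for record `3465d1`. [folklore] -/
theorem card_c3465d1_13 :
    Nat.card (((⟨1, -1, 1, 75868, 4172014⟩ : WeierstrassCurve ℤ).map (Int.castRingHom (ZMod 13))).toAffine.Point) = 16 := by
  rw [@WeierstrassCurve.natCard_point_eq_one_add_card (ZMod 13) (@ZMod.instField 13 ⟨by norm_num⟩) _ _ _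
    (by decide +kernel), @card_sol_eq_sum_euler (ZMod 13) (@ZMod.instField 13 ⟨by norm_num⟩) _ _
    (by rw [ZMod.ringChar_zmod_n]; decide), ZMod.card]
  decide +kernel

/-- `#Ẽ(𝔽_11) = 18` (`a_11 = -6`; `X² − a_11X + 11` root-free mod `p = 5`) for record `4230bg1`. [folklore] -/
theorem card_c4230bg1_11 :
    Nat.card (((⟨1, -1, 1, 11308, 325559⟩ : WeierstrassCurve ℤ).map (Int.castRingHom (ZMod 11))).toAffine.Point) = 18 := by
  rw [@WeierstrassCurve.natCard_point_eq_one_add_card (ZMod 11) (@ZMod.instField 11 ⟨by norm_num⟩) _ _ _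
    (by decide +kernel), @card_sol_eq_sum_euler (ZMod 11) (@ZMod.instField 11 ⟨by norm_num⟩) _ _
    (by rw [ZMod.ringChar_zmod_n]; decide), ZMod.card]
  decide +kernel

/-- `#Ẽ(𝔽_17) = 24` (`a_17 = -6`; `X² − a_17X + 17` root-free mod `p = 5`) for record `4230h1`. [folklore] -/
theorem card_c4230h1_17 :
    Nat.card (((⟨1, -1, 0, 9005511, 14046597485⟩ : WeierstrassCurve ℤ).map (Int.castRingHom (ZMod 17))).toAffine.Point) = 24 := by
  rw [@WeierstrassCurve.natCard_point_eq_one_add_card (ZMod 17) (@ZMod.instField 17 ⟨by norm_num⟩) _ _ _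
    (by decide +kernel), @card_sol_eq_sum_euler (ZMod 17) (@ZMod.instField 17 ⟨by norm_num⟩) _ _
    (by rw [ZMod.ringChar_zmod_n]; decide), ZMod.card]
  decide +kernel

/-- `#Ẽ(𝔽_7) = 12` (`a_7 = -4`; `X² − a_7X + 7` root-free mod `p = 5`) for record `4590o1`. [folklore] -/
theorem card_c4590o1_7 :
    Nat.card (((⟨1, -1, 1, -1877, 429⟩ : WeierstrassCurve ℤ).map (Int.castRingHom (ZMod 7))).toAffine.Point) = 12 := by
  rw [@WeierstrassCurve.natCard_point_eq_one_add_card (ZMod 7) (@ZMod.instField 7 ⟨by norm_num⟩) _ _ _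
    (by decide +kernel), @card_sol_eq_sum_euler (ZMod 7) (@ZMod.instField 7 ⟨by norm_num⟩) _ _
    (by rw [ZMod.ringChar_zmod_n]; decide), ZMod.card]
  decide +kernel

/-- `#Ẽ(𝔽_19) = 22` (`a_19 = -2`; `X² − a_19X + 19` root-free mod `p = 5`) for record `6240be1`. [folklore] -/
theorem card_c6240be1_19 :
    Nat.card (((⟨0, 1, 0, 4675, 27723⟩ : WeierstrassCurve ℤ).map (Int.castRingHom (ZMod 19))).toAffine.Point) = 22 := by
  rw [@WeierstrassCurve.natCard_point_eq_one_add_card (ZMod 19) (@ZMod.instField 19 ⟨by norm_num⟩) _ _ _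
    (by decide +kernel), @card_sol_eq_sum_euler (ZMod 19) (@ZMod.instField 19 ⟨by norm_num⟩) _ _
    (by rw [ZMod.ringChar_zmod_n]; decide), ZMod.card]
  decide +kernel

/-- `#Ẽ(𝔽_7) = 9` (`a_7 = -1`; `X² − a_7X + 7` root-free mod `p = 5`) for record `6390k1`. [folklore] -/
theorem card_c6390k1_7 :
    Nat.card (((⟨1, -1, 0, -3744, -84992⟩ : WeierstrassCurve ℤ).map (Int.castRingHom (ZMod 7))).toAffine.Point) = 9 := by
  rw [@WeierstrassCurve.natCard_point_eq_one_add_card (ZMod 7) (@ZMod.instField 7 ⟨by norm_num⟩) _ _ _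
    (by decide +kernel), @card_sol_eq_sum_euler (ZMod 7) (@ZMod.instField 7 ⟨by norm_num⟩) _ _
    (by rw [ZMod.ringChar_zmod_n]; decide), ZMod.card]
  decide +kernel

/-- `#Ẽ(𝔽_7) = 7` (`a_7 = 1`; `X² − a_7X + 7` root-free mod `p = 5`) for record `6390p1`. [folklore] -/
theorem card_c6390p1_7 :
    Nat.card (((⟨1, -1, 1, -248, 1347⟩ : WeierstrassCurve ℤ).map (Int.castRingHom (ZMod 7))).toAffine.Point) = 7 := by
  rw [@WeierstrassCurve.natCard_point_eq_one_add_card (ZMod 7) (@ZMod.instField 7 ⟨by norm_num⟩) _ _ _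
    (by decide +kernel), @card_sol_eq_sum_euler (ZMod 7) (@ZMod.instField 7 ⟨by norm_num⟩) _ _
    (by rw [ZMod.ringChar_zmod_n]; decide), ZMod.card]
  decide +kernel

/-- `#Ẽ(𝔽_17) = 23` (`a_17 = -5`; `X² − a_17X + 17` root-free mod `p = 5`) for record `6960r1`. [folklore] -/
theorem card_c6960r1_17 :
    Nat.card (((⟨0, 1, 0, 1820, 41303⟩ : WeierstrassCurve ℤ).map (Int.castRingHom (ZMod 17))).toAffine.Point) = 23 := by
  rw [@WeierstrassCurve.natCard_point_eq_one_add_card (ZMod 17) (@ZMod.instField 17 ⟨by norm_num⟩) _ _ _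
    (by decide +kernel), @card_sol_eq_sum_euler (ZMod 17) (@ZMod.instField 17 ⟨by norm_num⟩) _ _
    (by rw [ZMod.ringChar_zmod_n]; decide), ZMod.card]
  decide +kernel

/-- `#Ẽ(𝔽_17) = 22` (`a_17 = -4`; `X² − a_17X + 17` root-free mod `p = 5`) for record `7560e1`. [folklore] -/
theorem card_c7560e1_17 :
    Nat.card (((⟨0, 0, 0, -9747, 370494⟩ : WeierstrassCurve ℤ).map (Int.castRingHom (ZMod 17))).toAffine.Point) = 22 := by
  rw [@WeierstrassCurve.natCard_point_eq_one_add_card (ZMod 17) (@ZMod.instField 17 ⟨by norm_num⟩) _ _ _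
    (by decide +kernel), @card_sol_eq_sum_euler (ZMod 17) (@ZMod.instField 17 ⟨by norm_num⟩) _ _
    (by rw [ZMod.ringChar_zmod_n]; decide), ZMod.card]
  decide +kernel

/-- `#Ẽ(𝔽_13) = 14` (`a_13 = 0`; `X² − a_13X + 13` root-free mod `p = 5`) for record `8085y1`. [folklore] -/
theorem card_c8085y1_13 :
    Nat.card (((⟨0, 1, 1, -6435, -644416⟩ : WeierstrassCurve ℤ).map (Int.castRingHom (ZMod 13))).toAffine.Point) = 14 := by
  rw [@WeierstrassCurve.natCard_point_eq_one_add_card (ZMod 13) (@ZMod.instField 13 ⟨by norm_num⟩) _ _ _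
    (by decide +kernel), @card_sol_eq_sum_euler (ZMod 13) (@ZMod.instField 13 ⟨by norm_num⟩) _ _
    (by rw [ZMod.ringChar_zmod_n]; decide), ZMod.card]
  decide +kernel

/-- `#Ẽ(𝔽_7) = 8` (`a_7 = 0`; `X² − a_7X + 7` root-free mod `p = 5`) for record `8670u1`. [folklore] -/
theorem card_c8670u1_7 :
    Nat.card (((⟨1, 0, 0, 249, 3465⟩ : WeierstrassCurve ℤ).map (Int.castRingHom (ZMod 7))).toAffine.Point) = 8 := by
  rw [@WeierstrassCurve.natCard_point_eq_one_add_card (ZMod 7) (@ZMod.instField 7 ⟨by norm_num⟩) _ _ _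
    (by decide +kernel), @card_sol_eq_sum_euler (ZMod 7) (@ZMod.instField 7 ⟨by norm_num⟩) _ _
    (by rw [ZMod.ringChar_zmod_n]; decide), ZMod.card]
  decide +kernel

/-- `#Ẽ(𝔽_11) = 13` (`a_11 = -1`; `X² − a_11X + 11` root-free mod `p = 7`) for record `8946p1`. [folklore] -/
theorem card_c8946p1_11 :
    Nat.card (((⟨1, -1, 1, -10127, 6620887⟩ : WeierstrassCurve ℤ).map (Int.castRingHom (ZMod 11))).toAffine.Point) = 13 := by
  rw [@WeierstrassCurve.natCard_point_eq_one_add_card (ZMod 11) (@ZMod.instField 11 ⟨by norm_num⟩) _ _ _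
    (by decide +kernel), @card_sol_eq_sum_euler (ZMod 11) (@ZMod.instField 11 ⟨by norm_num⟩) _ _
    (by rw [ZMod.ringChar_zmod_n]; decide), ZMod.card]
  decide +kernel

/-- `#Ẽ(𝔽_7) = 7` (`a_7 = 1`; `X² − a_7X + 7` root-free mod `p = 5`) for record `9090n1`. [folklore] -/
theorem card_c9090n1_7 :
    Nat.card (((⟨1, -1, 1, 37528, -2701781⟩ : WeierstrassCurve ℤ).map (Int.castRingHom (ZMod 7))).toAffine.Point) = 7 := by
  rw [@WeierstrassCurve.natCard_point_eq_one_add_card (ZMod 7) (@ZMod.instField 7 ⟨by norm_num⟩) _ _ _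
    (by decide +kernel), @card_sol_eq_sum_euler (ZMod 7) (@ZMod.instField 7 ⟨by norm_num⟩) _ _
    (by rw [ZMod.ringChar_zmod_n]; decide), ZMod.card]
  decide +kernel

/-- `#Ẽ(𝔽_11) = 12` (`a_11 = 0`; `X² − a_11X + 11` root-free mod `p = 7`) for record `9954j1`. [folklore] -/
theorem card_c9954j1_11 :
    Nat.card (((⟨1, -1, 1, -12229835, 16464562395⟩ : WeierstrassCurve ℤ).map (Int.castRingHom (ZMod 11))).toAffine.Point) = 12 := by
  rw [@WeierstrassCurve.natCard_point_eq_one_add_card (ZMod 11) (@ZMod.instField 11 ⟨by norm_num⟩) _ _ _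
    (by decide +kernel), @card_sol_eq_sum_euler (ZMod 11) (@ZMod.instField 11 ⟨by norm_num⟩) _ _
    (by rw [ZMod.ringChar_zmod_n]; decide), ZMod.card]
  decide +kernel

/-- `#Ẽ(𝔽_17) = 13` (`a_17 = 5`; `X² − a_17X + 17` root-free mod `p = 7`) for record `10080bo1`. [folklore] -/
theorem card_c10080bo1_17 :
    Nat.card (((⟨0, 0, 0, -13368, 1032208⟩ : WeierstrassCurve ℤ).map (Int.castRingHom (ZMod 17))).toAffine.Point) = 13 := by
  rw [@WeierstrassCurve.natCard_point_eq_one_add_card (ZMod 17) (@ZMod.instField 17 ⟨by norm_num⟩) _ _ _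
    (by decide +kernel), @card_sol_eq_sum_euler (ZMod 17) (@ZMod.instField 17 ⟨by norm_num⟩) _ _
    (by rw [ZMod.ringChar_zmod_n]; decide), ZMod.card]
  decide +kernel

/-- `#Ẽ(𝔽_11) = 13` (`a_11 = -1`; `X² − a_11X + 11` root-free mod `p = 5`) for record `10080ca1`. [folklore] -/
theorem card_c10080ca1_11 :
    Nat.card (((⟨0, 0, 0, -2712, 54416⟩ : WeierstrassCurve ℤ).map (Int.castRingHom (ZMod 11))).toAffine.Point) = 13 := by
  rw [@WeierstrassCurve.natCard_point_eq_one_add_card (ZMod 11) (@ZMod.instField 11 ⟨by norm_num⟩) _ _ _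
    (by decide +kernel), @card_sol_eq_sum_euler (ZMod 11) (@ZMod.instField 11 ⟨by norm_num⟩) _ _
    (by rw [ZMod.ringChar_zmod_n]; decide), ZMod.card]
  decide +kernel

/-- `#Ẽ(𝔽_17) = 18` (`a_17 = 0`; `X² − a_17X + 17` root-free mod `p = 5`) for record `10530r1`. [folklore] -/
theorem card_c10530r1_17 :
    Nat.card (((⟨1, -1, 1, -498962, 176748049⟩ : WeierstrassCurve ℤ).map (Int.castRingHom (ZMod 17))).toAffine.Point) = 18 := by
  rw [@WeierstrassCurve.natCard_point_eq_one_add_card (ZMod 17) (@ZMod.instField 17 ⟨by norm_num⟩) _ _ _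
    (by decide +kernel), @card_sol_eq_sum_euler (ZMod 17) (@ZMod.instField 17 ⟨by norm_num⟩) _ _
    (by rw [ZMod.ringChar_zmod_n]; decide), ZMod.card]
  decide +kernel

/-- `#Ẽ(𝔽_7) = 9` (`a_7 = -1`; `X² − a_7X + 7` root-free mod `p = 5`) for record `10890cc1`. [folklore] -/
theorem card_c10890cc1_7 :
    Nat.card (((⟨1, -1, 1, -7052, 229551⟩ : WeierstrassCurve ℤ).map (Int.castRingHom (ZMod 7))).toAffine.Point) = 9 := by
  rw [@WeierstrassCurve.natCard_point_eq_one_add_card (ZMod 7) (@ZMod.instField 7 ⟨by norm_num⟩) _ _ _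
    (by decide +kernel), @card_sol_eq_sum_euler (ZMod 7) (@ZMod.instField 7 ⟨by norm_num⟩) _ _
    (by rw [ZMod.ringChar_zmod_n]; decide), ZMod.card]
  decide +kernel

/-- `#Ẽ(𝔽_7) = 7` (`a_7 = 1`; `X² − a_7X + 7` root-free mod `p = 5`) for record `11280k1`. [folklore] -/
theorem card_c11280k1_7 :
    Nat.card (((⟨0, -1, 0, 4, 60⟩ : WeierstrassCurve ℤ).map (Int.castRingHom (ZMod 7))).toAffine.Point) = 7 := by
  rw [@WeierstrassCurve.natCard_point_eq_one_add_card (ZMod 7) (@ZMod.instField 7 ⟨by norm_num⟩) _ _ _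
    (by decide +kernel), @card_sol_eq_sum_euler (ZMod 7) (@ZMod.instField 7 ⟨by norm_num⟩) _ _
    (by rw [ZMod.ringChar_zmod_n]; decide), ZMod.card]
  decide +kernel

/-- `#Ẽ(𝔽_11) = 11` (`a_11 = 1`; `X² − a_11X + 11` root-free mod `p = 5`) for record `11340e1`. [folklore] -/
theorem card_c11340e1_11 :
    Nat.card (((⟨0, 0, 0, -237, 1409⟩ : WeierstrassCurve ℤ).map (Int.castRingHom (ZMod 11))).toAffine.Point) = 11 := by
  rw [@WeierstrassCurve.natCard_point_eq_one_add_card (ZMod 11) (@ZMod.instField 11 ⟨by norm_num⟩) _ _ _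
    (by decide +kernel), @card_sol_eq_sum_euler (ZMod 11) (@ZMod.instField 11 ⟨by norm_num⟩) _ _
    (by rw [ZMod.ringChar_zmod_n]; decide), ZMod.card]
  decide +kernel

/-- `#Ẽ(𝔽_13) = 20` (`a_13 = -6`; `X² − a_13X + 13` root-free mod `p = 7`) for record `11550cm1`. [folklore] -/
theorem card_c11550cm1_13 :
    Nat.card (((⟨1, 0, 0, -4960463, -4242200583⟩ : WeierstrassCurve ℤ).map (Int.castRingHom (ZMod 13))).toAffine.Point) = 20 := by
  rw [@WeierstrassCurve.natCard_point_eq_one_add_card (ZMod 13) (@ZMod.instField 13 ⟨by norm_num⟩) _ _ _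
    (by decide +kernel), @card_sol_eq_sum_euler (ZMod 13) (@ZMod.instField 13 ⟨by norm_num⟩) _ _
    (by rw [ZMod.ringChar_zmod_n]; decide), ZMod.card]
  decide +kernel

/-- `#Ẽ(𝔽_13) = 16` (`a_13 = -2`; `X² − a_13X + 13` root-free mod `p = 11`) for record `11550cq1`. [folklore] -/
theorem card_c11550cq1_13 :
    Nat.card (((⟨1, 0, 0, 5337, 134217⟩ : WeierstrassCurve ℤ).map (Int.castRingHom (ZMod 13))).toAffine.Point) = 16 := by
  rw [@WeierstrassCurve.natCard_point_eq_one_add_card (ZMod 13) (@ZMod.instField 13 ⟨by norm_num⟩) _ _ _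
    (by decide +kernel), @card_sol_eq_sum_euler (ZMod 13) (@ZMod.instField 13 ⟨by norm_num⟩) _ _
    (by rw [ZMod.ringChar_zmod_n]; decide), ZMod.card]
  decide +kernel

/-- `#Ẽ(𝔽_11) = 16` (`a_11 = -4`; `X² − a_11X + 11` root-free mod `p = 5`) for record `11760bc1`. [folklore] -/
theorem card_c11760bc1_11 :
    Nat.card (((⟨0, 1, 0, -65, 363⟩ : WeierstrassCurve ℤ).map (Int.castRingHom (ZMod 11))).toAffine.Point) = 16 := by
  rw [@WeierstrassCurve.natCard_point_eq_one_add_card (ZMod 11) (@ZMod.instField 11 ⟨by norm_num⟩) _ _ _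
    (by decide +kernel), @card_sol_eq_sum_euler (ZMod 11) (@ZMod.instField 11 ⟨by norm_num⟩) _ _
    (by rw [ZMod.ringChar_zmod_n]; decide), ZMod.card]
  decide +kernel

/-- `#Ẽ(𝔽_13) = 15` (`a_13 = -1`; `X² − a_13X + 13` root-free mod `p = 7`) for record `11970be1`. [folklore] -/
theorem card_c11970be1_13 :
    Nat.card (((⟨1, -1, 1, -390338, 94793281⟩ : WeierstrassCurve ℤ).map (Int.castRingHom (ZMod 13))).toAffine.Point) = 15 := by
  rw [@WeierstrassCurve.natCard_point_eq_one_add_card (ZMod 13) (@ZMod.instField 13 ⟨by norm_num⟩) _ _ _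
    (by decide +kernel), @card_sol_eq_sum_euler (ZMod 13) (@ZMod.instField 13 ⟨by norm_num⟩) _ _
    (by rw [ZMod.ringChar_zmod_n]; decide), ZMod.card]
  decide +kernel

/-- `#Ẽ(𝔽_7) = 9` (`a_7 = -1`; `X² − a_7X + 7` root-free mod `p = 5`) for record `12330w1`. [folklore] -/
theorem card_c12330w1_7 :
    Nat.card (((⟨1, -1, 1, -11417, 470009⟩ : WeierstrassCurve ℤ).map (Int.castRingHom (ZMod 7))).toAffine.Point) = 9 := by
  rw [@WeierstrassCurve.natCard_point_eq_one_add_card (ZMod 7) (@ZMod.instField 7 ⟨by norm_num⟩) _ _ _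
    (by decide +kernel), @card_sol_eq_sum_euler (ZMod 7) (@ZMod.instField 7 ⟨by norm_num⟩) _ _
    (by rw [ZMod.ringChar_zmod_n]; decide), ZMod.card]
  decide +kernel

/-- `#Ẽ(𝔽_7) = 9` (`a_7 = -1`; `X² − a_7X + 7` root-free mod `p = 5`) for record `12360d1`. [folklore] -/
theorem card_c12360d1_7 :
    Nat.card (((⟨0, 1, 0, -54039736, 163695868064⟩ : WeierstrassCurve ℤ).map (Int.castRingHom (ZMod 7))).toAffine.Point) = 9 := by
  rw [@WeierstrassCurve.natCard_point_eq_one_add_card (ZMod 7) (@ZMod.instField 7 ⟨by norm_num⟩) _ _ _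
    (by decide +kernel), @card_sol_eq_sum_euler (ZMod 7) (@ZMod.instField 7 ⟨by norm_num⟩) _ _
    (by rw [ZMod.ringChar_zmod_n]; decide), ZMod.card]
  decide +kernel

/-- `#Ẽ(𝔽_7) = 9` (`a_7 = -1`; `X² − a_7X + 7` root-free mod `p = 5`) for record `12510n1`. [folklore] -/
theorem card_c12510n1_7 :
    Nat.card (((⟨1, -1, 1, 183028, -89555281⟩ : WeierstrassCurve ℤ).map (Int.castRingHom (ZMod 7))).toAffine.Point) = 9 := by
  rw [@WeierstrassCurve.natCard_point_eq_one_add_card (ZMod 7) (@ZMod.instField 7 ⟨by norm_num⟩) _ _ _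
    (by decide +kernel), @card_sol_eq_sum_euler (ZMod 7) (@ZMod.instField 7 ⟨by norm_num⟩) _ _
    (by rw [ZMod.ringChar_zmod_n]; decide), ZMod.card]
  decide +kernel

/-- `#Ẽ(𝔽_7) = 8` (`a_7 = 0`; `X² − a_7X + 7` root-free mod `p = 5`) for record `12540k1`. [folklore] -/
theorem card_c12540k1_7 :
    Nat.card (((⟨0, 1, 0, -61484225, 185543377500⟩ : WeierstrassCurve ℤ).map (Int.castRingHom (ZMod 7))).toAffine.Point) = 8 := by
  rw [@WeierstrassCurve.natCard_point_eq_one_add_card (ZMod 7) (@ZMod.instField 7 ⟨by norm_num⟩) _ _ _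
    (by decide +kernel), @card_sol_eq_sum_euler (ZMod 7) (@ZMod.instField 7 ⟨by norm_num⟩) _ _
    (by rw [ZMod.ringChar_zmod_n]; decide), ZMod.card]
  decide +kernel

/-- `#Ẽ(𝔽_13) = 10` (`a_13 = 4`; `X² − a_13X + 13` root-free mod `p = 7`) for record `12705q1`. [folklore] -/
theorem card_c12705q1_13 :
    Nat.card (((⟨0, 1, 1, 65905, -3375619⟩ : WeierstrassCurve ℤ).map (Int.castRingHom (ZMod 13))).toAffine.Point) = 10 := by
  rw [@WeierstrassCurve.natCard_point_eq_one_add_card (ZMod 13) (@ZMod.instField 13 ⟨by norm_num⟩) _ _ _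
    (by decide +kernel), @card_sol_eq_sum_euler (ZMod 13) (@ZMod.instField 13 ⟨by norm_num⟩) _ _
    (by rw [ZMod.ringChar_zmod_n]; decide), ZMod.card]
  decide +kernel

/-- `#Ẽ(𝔽_11) = 13` (`a_11 = -1`; `X² − a_11X + 11` root-free mod `p = 5`) for record `12880g1`. [folklore] -/
theorem card_c12880g1_11 :
    Nat.card (((⟨0, 1, 0, -2071545, 1146907475⟩ : WeierstrassCurve ℤ).map (Int.castRingHom (ZMod 11))).toAffine.Point) = 13 := by
  rw [@WeierstrassCurve.natCard_point_eq_one_add_card (ZMod 11) (@ZMod.instField 11 ⟨by norm_num⟩) _ _ _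
    (by decide +kernel), @card_sol_eq_sum_euler (ZMod 11) (@ZMod.instField 11 ⟨by norm_num⟩) _ _
    (by rw [ZMod.ringChar_zmod_n]; decide), ZMod.card]
  decide +kernel

/-- `#Ẽ(𝔽_5) = 3` (`a_5 = 3`; `X² − a_5X + 5` root-free mod `p = 7`) for record `13104bu1`. [folklore] -/
theorem card_c13104bu1_5 :
    Nat.card (((⟨0, 0, 0, -5256, 146988⟩ : WeierstrassCurve ℤ).map (Int.castRingHom (ZMod 5))).toAffine.Point) = 3 := by
  rw [@WeierstrassCurve.natCard_point_eq_one_add_card (ZMod 5) (@ZMod.instField 5 ⟨by norm_num⟩) _ _ _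
    (by decide +kernel), @card_sol_eq_sum_euler (ZMod 5) (@ZMod.instField 5 ⟨by norm_num⟩) _ _
    (by rw [ZMod.ringChar_zmod_n]; decide), ZMod.card]
  decide +kernel

/-- `#Ẽ(𝔽_13) = 11` (`a_13 = 3`; `X² − a_13X + 13` root-free mod `p = 5`) for record `13230bi1`. [folklore] -/
theorem card_c13230bi1_13 :
    Nat.card (((⟨1, -1, 0, -9270, 346100⟩ : WeierstrassCurve ℤ).map (Int.castRingHom (ZMod 13))).toAffine.Point) = 11 := by
  rw [@WeierstrassCurve.natCard_point_eq_one_add_card (ZMod 13) (@ZMod.instField 13 ⟨by norm_num⟩) _ _ _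
    (by decide +kernel), @card_sol_eq_sum_euler (ZMod 13) (@ZMod.instField 13 ⟨by norm_num⟩) _ _
    (by rw [ZMod.ringChar_zmod_n]; decide), ZMod.card]
  decide +kernel

/-- `#Ẽ(𝔽_13) = 9` (`a_13 = 5`; `X² − a_13X + 13` root-free mod `p = 5`) for record `13230bq1`. [folklore] -/
theorem card_c13230bq1_13 :
    Nat.card (((⟨1, -1, 0, -52953819, 148317133733⟩ : WeierstrassCurve ℤ).map (Int.castRingHom (ZMod 13))).toAffine.Point) = 9 := by
  rw [@WeierstrassCurve.natCard_point_eq_one_add_card (ZMod 13) (@ZMod.instField 13 ⟨by norm_num⟩) _ _ _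
    (by decide +kernel), @card_sol_eq_sum_euler (ZMod 13) (@ZMod.instField 13 ⟨by norm_num⟩) _ _
    (by rw [ZMod.ringChar_zmod_n]; decide), ZMod.card]
  decide +kernel

/-- `#Ẽ(𝔽_11) = 16` (`a_11 = -4`; `X² − a_11X + 11` root-free mod `p = 5`) for record `13230cp1`. [folklore] -/
theorem card_c13230cp1_11 :
    Nat.card (((⟨1, -1, 1, -83, -7073⟩ : WeierstrassCurve ℤ).map (Int.castRingHom (ZMod 11))).toAffine.Point) = 16 := by
  rw [@WeierstrassCurve.natCard_point_eq_one_add_card (ZMod 11) (@ZMod.instField 11 ⟨by norm_num⟩) _ _ _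
    (by decide +kernel), @card_sol_eq_sum_euler (ZMod 11) (@ZMod.instField 11 ⟨by norm_num⟩) _ _
    (by rw [ZMod.ringChar_zmod_n]; decide), ZMod.card]
  decide +kernel

/-- `#Ẽ(𝔽_11) = 11` (`a_11 = 1`; `X² − a_11X + 11` root-free mod `p = 5`) for record `13230dt1`. [folklore] -/
theorem card_c13230dt1_11 :
    Nat.card (((⟨1, -1, 1, -321572, 71118919⟩ : WeierstrassCurve ℤ).map (Int.castRingHom (ZMod 11))).toAffine.Point) = 11 := by
  rw [@WeierstrassCurve.natCard_point_eq_one_add_card (ZMod 11) (@ZMod.instField 11 ⟨by norm_num⟩) _ _ _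
    (by decide +kernel), @card_sol_eq_sum_euler (ZMod 11) (@ZMod.instField 11 ⟨by norm_num⟩) _ _
    (by rw [ZMod.ringChar_zmod_n]; decide), ZMod.card]
  decide +kernel

/-- `#Ẽ(𝔽_5) = 8` (`a_5 = -2`; `X² − a_5X + 5` root-free mod `p = 11`) for record `13662g1`. [folklore] -/
theorem card_c13662g1_5 :
    Nat.card (((⟨1, -1, 0, 11112, 3802944⟩ : WeierstrassCurve ℤ).map (Int.castRingHom (ZMod 5))).toAffine.Point) = 8 := by
  rw [@WeierstrassCurve.natCard_point_eq_one_add_card (ZMod 5) (@ZMod.instField 5 ⟨by norm_num⟩) _ _ _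
    (by decide +kernel), @card_sol_eq_sum_euler (ZMod 5) (@ZMod.instField 5 ⟨by norm_num⟩) _ _
    (by rw [ZMod.ringChar_zmod_n]; decide), ZMod.card]
  decide +kernel

/-- `#Ẽ(𝔽_7) = 3` (`a_7 = 5`; `X² − a_7X + 7` root-free mod `p = 5`) for record `14040b1`. [folklore] -/
theorem card_c14040b1_7 :
    Nat.card (((⟨0, 0, 0, -1323, 32022⟩ : WeierstrassCurve ℤ).map (Int.castRingHom (ZMod 7))).toAffine.Point) = 3 := by
  rw [@WeierstrassCurve.natCard_point_eq_one_add_card (ZMod 7) (@ZMod.instField 7 ⟨by norm_num⟩) _ _ _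
    (by decide +kernel), @card_sol_eq_sum_euler (ZMod 7) (@ZMod.instField 7 ⟨by norm_num⟩) _ _
    (by rw [ZMod.ringChar_zmod_n]; decide), ZMod.card]
  decide +kernel

/-- `#Ẽ(𝔽_19) = 13` (`a_19 = 7`; `X² − a_19X + 19` root-free mod `p = 5`) for record `14130u1`. [folklore] -/
theorem card_c14130u1_19 :
    Nat.card (((⟨1, -1, 1, -56732, 7119839⟩ : WeierstrassCurve ℤ).map (Int.castRingHom (ZMod 19))).toAffine.Point) = 13 := by
  rw [@WeierstrassCurve.natCard_point_eq_one_add_card (ZMod 19) (@ZMod.instField 19 ⟨by norm_num⟩) _ _ _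
    (by decide +kernel), @card_sol_eq_sum_euler (ZMod 19) (@ZMod.instField 19 ⟨by norm_num⟩) _ _
    (by rw [ZMod.ringChar_zmod_n]; decide), ZMod.card]
  decide +kernel

/-- `#Ẽ(𝔽_19) = 22` (`a_19 = -2`; `X² − a_19X + 19` root-free mod `p = 5`) for record `14160e1`. [folklore] -/
theorem card_c14160e1_19 :
    Nat.card (((⟨0, -1, 0, -35880, 2778912⟩ : WeierstrassCurve ℤ).map (Int.castRingHom (ZMod 19))).toAffine.Point) = 22 := by
  rw [@WeierstrassCurve.natCard_point_eq_one_add_card (ZMod 19) (@ZMod.instField 19 ⟨by norm_num⟩) _ _ _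
    (by decide +kernel), @card_sol_eq_sum_euler (ZMod 19) (@ZMod.instField 19 ⟨by norm_num⟩) _ _
    (by rw [ZMod.ringChar_zmod_n]; decide), ZMod.card]
  decide +kernel

/-- `#Ẽ(𝔽_3) = 6` (`a_3 = -2`; `X² − a_3X + 3` root-free mod `p = 5`) for record `14210d1`. [folklore] -/
theorem card_c14210d1_3 :
    Nat.card (((⟨1, 0, 1, 243651, -209990728⟩ : WeierstrassCurve ℤ).map (Int.castRingHom (ZMod 3))).toAffine.Point) = 6 := by
  rw [@WeierstrassCurve.natCard_point_eq_one_add_card (ZMod 3) (@ZMod.instField 3 ⟨by norm_num⟩) _ _ _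
    (by decide +kernel), @card_sol_eq_sum_euler (ZMod 3) (@ZMod.instField 3 ⟨by norm_num⟩) _ _
    (by rw [ZMod.ringChar_zmod_n]; decide), ZMod.card]
  decide +kernel

/-- `#Ẽ(𝔽_13) = 16` (`a_13 = -2`; `X² − a_13X + 13` root-free mod `p = 5`) for record `14490bs1`. [folklore] -/
theorem card_c14490bs1_13 :
    Nat.card (((⟨1, -1, 1, -49478, 4221141⟩ : WeierstrassCurve ℤ).map (Int.castRingHom (ZMod 13))).toAffine.Point) = 16 := by
  rw [@WeierstrassCurve.natCard_point_eq_one_add_card (ZMod 13) (@ZMod.instField 13 ⟨by norm_num⟩) _ _ _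
    (by decide +kernel), @card_sol_eq_sum_euler (ZMod 13) (@ZMod.instField 13 ⟨by norm_num⟩) _ _
    (by rw [ZMod.ringChar_zmod_n]; decide), ZMod.card]
  decide +kernel

/-- `#Ẽ(𝔽_13) = 16` (`a_13 = -2`; `X² − a_13X + 13` root-free mod `p = 5`) for record `14490bv1`. [folklore] -/
theorem card_c14490bv1_13 :
    Nat.card (((⟨1, -1, 1, -2586677, -1006001971⟩ : WeierstrassCurve ℤ).map (Int.castRingHom (ZMod 13))).toAffine.Point) = 16 := by
  rw [@WeierstrassCurve.natCard_point_eq_one_add_card (ZMod 13) (@ZMod.instField 13 ⟨by norm_num⟩) _ _ _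
    (by decide +kernel), @card_sol_eq_sum_euler (ZMod 13) (@ZMod.instField 13 ⟨by norm_num⟩) _ _
    (by rw [ZMod.ringChar_zmod_n]; decide), ZMod.card]
  decide +kernel

end Summit.BirchSwinnertonDyer.BirchSwinnertonDyer.Rank1Residual.X11RankOne
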